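import Literature.MathematicalPhysics.QuantumFieldTheory.Balaban1983to89.B11Eq103H1Complex

/-!
# `Balaban1983to89.B9Eq323KatoDomination` — T. Bałaban, *Propagators for lattice gauge theories in a background field*, Commun. Math. Phys. **99** (1985)
# 389–434 [Balaban1985BackgroundPropagators] (3.23) p. 394 (the covariant Laplace operator `Δ^η_U = D*_U D_U` on the gauge parameters), (3.39) p. 397 (the
# supremum norms `|λ| = sup_x |λ(x)|` in which Theorem 3.1 is stated): **KATO's INEQUALITY ON THE LATTICE AND THE MAXIMUM PRINCIPLE FOR THE COVARIANT
# RESOLVENT — `‖u(x)‖·(Δ^η‖u‖)(x) ≤ Re⟨u(x), (Δ^η_U u)(x)⟩` pointwise for CONTRACTIVE parallel transporters (every unitary background, NO small-field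
# hypothesis), hence `‖(Δ^η_U + m)⁻¹f‖_∞ ≤ m⁻¹‖f‖_∞` and the DOMINATION `‖((Δ^η_U + m)⁻¹f)(x)‖ ≤ ((Δ^η + m)⁻¹g)(x)` whenever `‖f‖ ≤ g` — level-free and
# volume-free sup-norm letters** — stone (K)+(MP) of the NE9 owner's SUP-NORM PROGRAMME (plan v10) toward the VALUE row of Theorem 3.1 (3.42) at the top level

statement-level skeleton of published theorems with citation tags; proofs where landed; nothing here is a claim about the Yang–Mills mass gap

CITATION HEADER (lean-in-tree rule).  Audit cell `pub-balaban`, sub-cell `t4`, BINDER row NE9; filed by the row OWNER lineage `b2b-balaban-t4-ne9-p1` (gen 89,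
plan v10 «the sup-norm programme»).  Source READ first-hand in the held text layer [Balaban1985BackgroundPropagators] (`paper:balaban1985-cmp99-background-propagators`,
journal page = PDF page + 388) pp. 394, 397–398: p. 394 (3.23) *«Δ^η_U = D*_U D_U»* (typed: `B11Eq103H1Complex.covLaplaceSiteK c R S = covDivL2K c S ∘ covDerivL2K c R`,
(3.3) `(D f)(b) = c·(R(b)f(b₊) − f(b₋))`, (3.8) `(D*A)(y) = c·Σ_μ(S(y−e_μ, μ)A(y−e_μ, μ) − A(y, μ))`); p. 397 (3.39) *«Thus we have the supremum norms |λ| = max sup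
|λ_μ(x)|, …»*; p. 397 Thm 3.1 *«There exist positive constants M₁, δ₀, a₀, B₀ dependent on d and L only … the operator G′(U) (a = 1) satisfies the inequalities
[(3.42)]»*; p. 398 *«All these inequalities are invariant with respect to gauge transformations of U.»*  Print proves Thm 3.1 by a random-walk expansion (p. 398
*«We will prove the above theorem by constructing a random walk representation similar to that in (2.40) …»*); NOTHING of that proof is reproduced here.  This file
supplies the cell's SUBSTITUTE first step for the VALUE row of (3.42): a positivity argument ([folklore] T. Kato's inequality `Δ|u| ≤ Re(sgn ū·Δ_A u)`, here in its
lattice form for Ad-covariant differences, and the finite-dimensional maximum principle).  THE DISCRETE SOURCE (read first-hand, held text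
`paper:arxiv-math_0312450` = [DodziukMathai2006] J. Dodziuk, V. Mathai, *Kato's inequality and asymptotic spectral properties for discrete magnetic Laplacians*,
Contemp. Math. **398** (2006) 69–81, §1): Lemma 1.1 *«Suppose f ∈ C⁰₍₂₎(K) is a real-valued function and λ > 0. If (Δ + λI)f ≥ 0, then f ≥ 0 i.e. (Δ + λI)⁻¹ is
positivity preserving.»* (proof: *«attains a negative minimum at a vertex v₀ … the right-hand side is strictly negative»*); (1.2) *«Δ_σ f(v) = Σ_{w∼v}(f(v) −
σ([w,v])f(w))»* for a `U(1)`-valued multiplier `σ`; Lemma 1.2 *«For every f ∈ C⁰₍₂₎(K), one has the pointwise inequality: |f|·Δ|f| ≤ Re(Δ_σ f · f̄).»*; Theorem 1.5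
*«For every multiplier σ and every f ∈ C⁰₍₂₎(K) we have |e^{−tΔ_σ}f| ≤ e^{−tΔ}|f| pointwise.»*  HERE: the multiplier `σ([w,v]) ∈ U(1)` is replaced by an
arbitrary CONTRACTION `T` of an inner-product fibre (Ad of a unitary bond variable on `𝔤ᶜ`), the edges carry weights `w ≥ 0` (print's `η⁻²`), and the
domination is stated for the RESOLVENT `(Δ_σ + m)⁻¹` (the form the programme uses) rather than the semigroup; the proofs are the printed two-line arguments.

WHY THIS FILE (cell context; owner DIAGNOSIS D-ne9p1-g89-1, journal [NE9P1-G89-ONLINE]).  After the Δ_π port (gens 86–88) the k-level chart letters of print's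
operator are bounded in the chart's Banach type by `C·V` with `C` level-free and `V` carrying the finite-lattice factors of `B11Eq117TransformationNorm`
(`√(c₁#β)∕√c₀ = √(d∏m_i)·(L^{n+1})^{d∕2}` at the diagonal: VOLUME × LEVEL).  The space (115) is a weighted SUP norm (`B11Eq115Space.NegSup.norm_def`), so an
`L²`-operator-norm block decay cannot remove the level factor (the passage `L²(unit block) → sup` costs `c₀^{−1∕2}`); a level-free (117) is exactly a BLOCK SUP→SUP
bound of print's (3.42) shape, read into (115) by `B11Eq115KernelOp.norm_kernelCLM_le_of_rowSum_le` (ne9-leaf-03 g52).  The programme obtains the VALUE row of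
(3.42) at the top level for the chain's site Green's function from: (K) this file's Kato inequality, (MP) this file's maximum principle ∕ domination, (FS) the free
scalar letter `‖(Δ^η + M²)⁻²‖_{L²→L^∞} ≤ C₃` (to be filed), (CT) the chain's energy bound and `L²` block decay of `G′_k(U)` (`B9Eq349ConjugatedGreenLetters.norm_Gk_le`,
`B9Eq349ConjugatedGreenBlockDecay.exists_block_decay_Gp`, in the tree), (A) the resolvent identity used twice.

WHAT IS PROVED (sorry-free; 0 `def`; [DodziukMathai2006] §1 generalised from `U(1)` multipliers to contractions, weighted).  §1–§2 ABSTRACT: a finite index type `ι` (sites), an index type `J` of neighbour slots, `nbr : ι → J → ι`,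
real weights `0 ≤ w x j`, transporters `T x j : V →ₗ[𝕜] V` with `‖T x j v‖ ≤ ‖v‖` on an inner-product space `V` over `RCLike 𝕜`; the covariant operator
`(L u)(x) = Σ_j (w x j : 𝕜)•(u x − T x j (u (nbr x j)))` and its scalar shadow `(L₀φ)(x) = Σ_j w x j·(φ x − φ (nbr x j))` are WRITTEN OUT in every statement.
* §1 **`kato_pointwise`** — `‖u x‖·Σ_j w x j·(‖u x‖ − ‖u (nbr x j)‖) ≤ re⟪u x, (L u)(x)⟫` (from `re⟪u x, T v⟫ ≤ ‖u x‖‖v‖`).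
* §2 **`norm_le_of_resolvent`** — `L u + m u = f`, `0 < m`, `‖f y‖ ≤ F` for all `y` ⟹ `‖u x‖ ≤ F∕m` (Kato at a maximum point of `‖u‖`); `eq_zero_of_resolvent_zero`;
  **`scalar_nonneg_of_resolvent`** ∕ **`scalar_le_of_resolvent`** — `L₀φ + mφ = g`: `0 ≤ g ⟹ 0 ≤ φ`, `g ≤ Gs ⟹ φ ≤ Gs∕m`; **`norm_le_scalar_of_resolvent`** — DOMINATION:
  `L u + m u = f`, `L₀φ + mφ = g`, `‖f x‖ ≤ g x` for all `x` ⟹ `‖u x‖ ≤ φ x` for all `x` (Kato at a maximum point of `‖u‖ − φ`); **`exists_resolvent`** ∕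
  **`exists_scalar_resolvent`** — the equations `L u + m u = f`, `L₀φ + mφ = g` are (uniquely) solvable (`V` finite-dimensional: injective ⟹ surjective).
* §3 THE CHAIN's (3.23): for `covLaplaceSiteK (t : 𝕜) R S` on `SiteL2K 𝕜 d Pd c₀ W` with `S b (R b w) = w` and `R b`, `S b` contractions (Ad of a unitary
  background read on an Ad-invariant fibre norm) and a REAL difference quotient `t` (= η⁻¹): **`equiv_covLaplaceSiteK_eq_sum`** (the pointwise form
  `t²·Σ_μ[(f x − S(x−e_μ,μ)f(x−e_μ)) + (f x − R(x,μ)f(x+e_μ))]`), **`kato_covLaplaceSiteK`** (§1 for (3.23)), **`norm_le_of_covLaplaceSiteK_resolvent`**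
  (`Δ^η_U f + m f = g ⟹ ‖f(x)‖ ≤ sup‖g‖∕m`), **`norm_le_scalar_of_covLaplaceSiteK_resolvent`** (domination by the flat scalar resolvent equation, written out).
HONEST SCOPE.  Positivity only: no decay rate, no small-field window, no `Q′*Q′` term (the averaging penalty of (3.24) is NOT of Kato form and is treated as a
bounded source in the programme's assembly, not here); the ∇-row of (3.42) is out of reach of this method (print's Hölder norms (3.40)).  NOT summit progress
(cell pub-balaban: NE9 NOT PRINTED ∕ NOT PROVED; «NE9 ⇐ the named binders»; row WALLED ON A MODEL (O-NE9-1; #5 UNRULED); spine PROVED 0∕9; rung (B)+1 finite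
T⁴ — NOT infinite volume, NOT mass gap, NOT BetaPertH, NOT Clay).  HONEST DEPENDENCY (cell line): continuum YM on T⁴ ⇐ BetaPertH ∧ nine spine estimates (0/9
proved); BetaPertH ⇐ (D1) ∧ (D4) ∧ CAP+tail; G-an2-4 gates asym, D1 and NE2/3/4.  NEW file importing `B11Eq103H1Complex` only; nothing modified.  Net new unproved facts: 0.
-/

noncomputable section

open scoped InnerProductSpace ComplexConjugate BigOperators

namespace Literature.MathematicalPhysics.QuantumFieldTheory.Balaban1983to89.B9Eq323KatoDomination

open B4Sect5Torus (TSite)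
open B9SectCLatticeCarrier (Bond shift unshift shift_unshift)
open B9Eq33CovDerivVector (covDeriv covDiv covDeriv_apply_dir covDiv_apply)
open B9Eq311L2Pairing (WL2)
open B11Eq103H1Complex (SiteL2K covLaplaceSiteK equiv_covDerivL2K equiv_covDivL2K)

/-! ## §1 Kato's inequality on a finite weighted graph with contractive transporters -/

section Abstract

variable {𝕜 : Type*} [RCLike 𝕜] {V : Type*} [NormedAddCommGroup V] [InnerProductSpace 𝕜 V]
  {ι J : Type*} [Fintype J]

/-- One edge of Kato's inequality: for a contraction `T`, `‖a‖·(‖a‖ − ‖b‖) ≤ re⟪a, a − T b⟫` (Cauchy–Schwarz) — the summand of [DodziukMathai2006] Lemma 1.2's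
proof *«Σ_{w∼v} Re(σ([w,v])f(w)f̄(v) − |f(v)|·|f(w)|) ≤ 0»*. [cite: DodziukMathai2006, Lemma 1.2 §1] -/
theorem kato_edge (T : V →ₗ[𝕜] V) (hT : ∀ v, ‖T v‖ ≤ ‖v‖) (a b : V) :
    ‖a‖ * (‖a‖ - ‖b‖) ≤ RCLike.re ⟪a, a - T b⟫_𝕜 := by
  rw [inner_sub_right, map_sub, inner_self_eq_norm_sq (𝕜 := 𝕜)]
  have h1 : RCLike.re ⟪a, T b⟫_𝕜 ≤ ‖a‖ * ‖b‖ :=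
    (RCLike.re_le_norm _).trans ((norm_inner_le_norm _ _).trans (mul_le_mul_of_nonneg_left (hT b) (norm_nonneg a)))
  nlinarith [h1]

/-- **KATO's INEQUALITY (lattice, pointwise)**: for the covariant operator `(L u)(x) = Σ_j (w x j)•(u x − T x j (u (nbr x j)))` with real weights `w ≥ 0` and
contractive transporters, `‖u x‖·Σ_j w x j·(‖u x‖ − ‖u (nbr x j)‖) ≤ re⟪u x, (L u)(x)⟫` — the absolute value of a covariant field is a SUB-solution of the flat
weighted graph Laplacian wherever the covariant Laplacian is controlled — [DodziukMathai2006] Lemma 1.2 *«|f|·Δ|f| ≤ Re(Δ_σ f · f̄)»* with the `U(1)`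
multiplier generalised to contractions and weighted edges. (For (3.23): `J = Fin d ⊕ Fin d`, `w = η⁻²`, `T` = Ad of the bond variables.)
[cite: DodziukMathai2006, Lemma 1.2 §1; Balaban1985BackgroundPropagators, (3.23) p.394] -/
theorem kato_pointwise (nbr : ι → J → ι) (w : ι → J → ℝ) (hw : ∀ x j, 0 ≤ w x j) (T : ι → J → V →ₗ[𝕜] V)
    (hT : ∀ x j v, ‖T x j v‖ ≤ ‖v‖) (u : ι → V) (x : ι) :
    ‖u x‖ * ∑ j, w x j * (‖u x‖ - ‖u (nbr x j)‖) ≤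
      RCLike.re ⟪u x, ∑ j, (w x j : 𝕜) • (u x - T x j (u (nbr x j)))⟫_𝕜 := by
  rw [Finset.mul_sum, inner_sum, map_sum]
  refine Finset.sum_le_sum fun j _ => ?_
  rw [inner_smul_right, RCLike.re_ofReal_mul]
  calc ‖u x‖ * (w x j * (‖u x‖ - ‖u (nbr x j)‖)) = w x j * (‖u x‖ * (‖u x‖ - ‖u (nbr x j)‖)) := by ring
    _ ≤ w x j * RCLike.re ⟪u x, u x - T x j (u (nbr x j))⟫_𝕜 :=
        mul_le_mul_of_nonneg_left (kato_edge (T x j) (hT x j) _ _) (hw x j)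

/-! ## §2 The maximum principle: sup-norm bound, positivity and domination for the resolvent `(L + m)⁻¹` -/

/-- The flat weighted graph Laplacian is nonnegative at a maximum point (the one-line heart of [DodziukMathai2006] Lemma 1.1's proof).
[cite: DodziukMathai2006, Lemma 1.1 §1] -/
theorem sum_nonneg_of_isMax (nbr : ι → J → ι) (w : ι → J → ℝ) (hw : ∀ x j, 0 ≤ w x j) (ψ : ι → ℝ) {x₀ : ι}
    (hx₀ : ∀ y, ψ y ≤ ψ x₀) : 0 ≤ ∑ j, w x₀ j * (ψ x₀ - ψ (nbr x₀ j)) :=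
  Finset.sum_nonneg fun j _ => mul_nonneg (hw x₀ j) (sub_nonneg.2 (hx₀ _))

variable [Fintype ι]

/-- **`‖(L + m)⁻¹‖_{∞→∞} ≤ m⁻¹` FOR THE COVARIANT RESOLVENT**: if `(L u)(x) + m·u(x) = f(x)` for all `x` with `0 < m` and `‖f(y)‖ ≤ F` for all `y`, then
`‖u(x)‖ ≤ F∕m` for all `x` — Kato's inequality ([DodziukMathai2006] Lemma 1.2) at a maximum point of `‖u‖`. Every contractive background, no window; the
letter is level-free and volume-free (the sup norms (3.39) of [Balaban1985BackgroundPropagators] Thm 3.1).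
[cite: DodziukMathai2006, Lemma 1.2 §1; Balaban1985BackgroundPropagators, (3.39) p.397] -/
theorem norm_le_of_resolvent (nbr : ι → J → ι) (w : ι → J → ℝ) (hw : ∀ x j, 0 ≤ w x j) (T : ι → J → V →ₗ[𝕜] V)
    (hT : ∀ x j v, ‖T x j v‖ ≤ ‖v‖) {m : ℝ} (hm : 0 < m) {u f : ι → V}
    (hu : ∀ x, ∑ j, (w x j : 𝕜) • (u x - T x j (u (nbr x j))) + (m : 𝕜) • u x = f x) {F : ℝ} (hF : ∀ y, ‖f y‖ ≤ F) (x : ι) :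
    ‖u x‖ ≤ F / m := by
  obtain ⟨x₀, -, hx₀⟩ := Finset.exists_max_image Finset.univ (fun y => ‖u y‖) ⟨x, Finset.mem_univ x⟩
  have hmax : ∀ y, ‖u y‖ ≤ ‖u x₀‖ := fun y => hx₀ y (Finset.mem_univ y)
  refine (hmax x).trans ?_
  rw [le_div_iff₀ hm]
  have hk := kato_pointwise nbr w hw T hT u x₀
  have h0 : 0 ≤ ‖u x₀‖ * ∑ j, w x₀ j * (‖u x₀‖ - ‖u (nbr x₀ j)‖) :=
    mul_nonneg (norm_nonneg _) (sum_nonneg_of_isMax nbr w hw (fun y => ‖u y‖) hmax)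
  have hL : ∑ j, (w x₀ j : 𝕜) • (u x₀ - T x₀ j (u (nbr x₀ j))) = f x₀ - (m : 𝕜) • u x₀ := eq_sub_of_add_eq (hu x₀)
  rw [hL, inner_sub_right, map_sub, inner_smul_right, RCLike.re_ofReal_mul, inner_self_eq_norm_sq (𝕜 := 𝕜)] at hk
  have h1 : RCLike.re ⟪u x₀, f x₀⟫_𝕜 ≤ ‖u x₀‖ * F :=
    (RCLike.re_le_norm _).trans ((norm_inner_le_norm _ _).trans (mul_le_mul_of_nonneg_left (hF x₀) (norm_nonneg _)))
  by_cases h : ‖u x₀‖ = 0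
  · rw [h, zero_mul]; exact le_trans (norm_nonneg (f x)) (hF x)
  · have hpos : 0 < ‖u x₀‖ := lt_of_le_of_ne (norm_nonneg _) (Ne.symm h)
    nlinarith [h0, hk, h1, hpos]

/-- Injectivity of `L + m`: `L u + m u = 0 ⟹ u = 0` (corollary of the sup bound). [cite: DodziukMathai2006, Lemma 1.2 §1] -/
theorem eq_zero_of_resolvent_zero (nbr : ι → J → ι) (w : ι → J → ℝ) (hw : ∀ x j, 0 ≤ w x j) (T : ι → J → V →ₗ[𝕜] V)
    (hT : ∀ x j v, ‖T x j v‖ ≤ ‖v‖) {m : ℝ} (hm : 0 < m) {u : ι → V}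
    (hu : ∀ x, ∑ j, (w x j : 𝕜) • (u x - T x j (u (nbr x j))) + (m : 𝕜) • u x = 0) : u = 0 := by
  funext x
  have h := norm_le_of_resolvent nbr w hw T hT hm (f := fun _ => 0) hu (F := 0) (fun _ => by simp) x
  rw [zero_div] at h
  exact norm_le_zero_iff.1 h

/-- **POSITIVITY OF THE SCALAR RESOLVENT** — [DodziukMathai2006] Lemma 1.1 *«If (Δ + λI)f ≥ 0, then f ≥ 0 i.e. (Δ + λI)⁻¹ is positivity preserving»* (weighted
edges): `(L₀φ)(x) + m·φ(x) = g(x) ≥ 0` for all `x`, `0 < m` ⟹ `0 ≤ φ(x)` (minimum point). [cite: DodziukMathai2006, Lemma 1.1 §1] -/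
theorem scalar_nonneg_of_resolvent (nbr : ι → J → ι) (w : ι → J → ℝ) (hw : ∀ x j, 0 ≤ w x j) {m : ℝ} (hm : 0 < m) {φ g : ι → ℝ}
    (hφ : ∀ x, ∑ j, w x j * (φ x - φ (nbr x j)) + m * φ x = g x) (hg : ∀ x, 0 ≤ g x) (x : ι) : 0 ≤ φ x := by
  obtain ⟨x₁, -, hx₁⟩ := Finset.exists_min_image Finset.univ φ ⟨x, Finset.mem_univ x⟩
  have hmin : ∀ y, φ x₁ ≤ φ y := fun y => hx₁ y (Finset.mem_univ y)
  refine le_trans ?_ (hmin x)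
  have h0 : ∑ j, w x₁ j * (φ x₁ - φ (nbr x₁ j)) ≤ 0 :=
    Finset.sum_nonpos fun j _ => mul_nonpos_of_nonneg_of_nonpos (hw x₁ j) (sub_nonpos.2 (hmin _))
  nlinarith [hφ x₁, hg x₁, h0]

/-- **`‖(L₀ + m)⁻¹‖_{∞→∞} ≤ m⁻¹` FOR THE SCALAR RESOLVENT (one-sided)**: `(L₀φ)(x) + m·φ(x) = g(x) ≤ G` for all `x` ⟹ `φ(x) ≤ G∕m` (maximum point; the
mirror image of [DodziukMathai2006] Lemma 1.1's proof). [cite: DodziukMathai2006, Lemma 1.1 §1] -/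
theorem scalar_le_of_resolvent (nbr : ι → J → ι) (w : ι → J → ℝ) (hw : ∀ x j, 0 ≤ w x j) {m : ℝ} (hm : 0 < m) {φ g : ι → ℝ}
    (hφ : ∀ x, ∑ j, w x j * (φ x - φ (nbr x j)) + m * φ x = g x) {G : ℝ} (hg : ∀ x, g x ≤ G) (x : ι) : φ x ≤ G / m := by
  obtain ⟨x₀, -, hx₀⟩ := Finset.exists_max_image Finset.univ φ ⟨x, Finset.mem_univ x⟩
  have hmax : ∀ y, φ y ≤ φ x₀ := fun y => hx₀ y (Finset.mem_univ y)
  refine (hmax x).trans ?_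
  rw [le_div_iff₀ hm]
  have h0 := sum_nonneg_of_isMax nbr w hw φ hmax
  nlinarith [hφ x₀, hg x₀, h0]

/-- **DOMINATION OF THE COVARIANT RESOLVENT BY THE SCALAR ONE**: if `L u + m u = f` (covariant, contractive transporters), `L₀φ + mφ = g` (flat scalar, the SAME
weights and neighbours) and `‖f(x)‖ ≤ g(x)` for all `x`, then `‖u(x)‖ ≤ φ(x)` for all `x` — Kato's inequality at a maximum point of `‖u‖ − φ`. PRINTED in the
proof of [DodziukMathai2006] Theorem 1.5: *«(Δ + λI)|(Δ_σ + λI)⁻¹f| ≤ |f|. Since (Δ + λI) is positivity preserving we obtain the (pointwise) inequality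
|(Δ_σ + λI)⁻¹f| ≤ (Δ + λI)⁻¹|f|»* (Remark 1.6: «actually equivalent» to the heat-kernel domination `|e^{−tΔ_σ}f| ≤ e^{−tΔ}|f|`); here with contractions
for the `U(1)` multiplier and weighted edges: the diamagnetic comparison `|(Δ_U + m)⁻¹f| ≤ (Δ + m)⁻¹|f|` on the lattice.
[cite: DodziukMathai2006, proof of Thm 1.5 + Remark 1.6 §1; Balaban1985BackgroundPropagators, (3.23) p.394] -/
theorem norm_le_scalar_of_resolvent (nbr : ι → J → ι) (w : ι → J → ℝ) (hw : ∀ x j, 0 ≤ w x j) (T : ι → J → V →ₗ[𝕜] V)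
    (hT : ∀ x j v, ‖T x j v‖ ≤ ‖v‖) {m : ℝ} (hm : 0 < m) {u f : ι → V} {φ g : ι → ℝ}
    (hu : ∀ x, ∑ j, (w x j : 𝕜) • (u x - T x j (u (nbr x j))) + (m : 𝕜) • u x = f x)
    (hφ : ∀ x, ∑ j, w x j * (φ x - φ (nbr x j)) + m * φ x = g x) (hfg : ∀ x, ‖f x‖ ≤ g x) (x : ι) : ‖u x‖ ≤ φ x := by
  obtain ⟨x₀, -, hx₀⟩ := Finset.exists_max_image Finset.univ (fun y => ‖u y‖ - φ y) ⟨x, Finset.mem_univ x⟩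
  have hmax : ∀ y, ‖u y‖ - φ y ≤ ‖u x₀‖ - φ x₀ := fun y => hx₀ y (Finset.mem_univ y)
  have hφ0 : 0 ≤ φ x₀ := scalar_nonneg_of_resolvent nbr w hw hm hφ (fun y => (norm_nonneg _).trans (hfg y)) x₀
  by_contra hx
  have hψ : 0 < ‖u x₀‖ - φ x₀ := lt_of_lt_of_le (by linarith) (hmax x)
  have hpos : 0 < ‖u x₀‖ := by linarith
  -- Kato at `x₀`
  have hk := kato_pointwise nbr w hw T hT u x₀
  have hL : ∑ j, (w x₀ j : 𝕜) • (u x₀ - T x₀ j (u (nbr x₀ j))) = f x₀ - (m : 𝕜) • u x₀ := eq_sub_of_add_eq (hu x₀)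
  rw [hL, inner_sub_right, map_sub, inner_smul_right, RCLike.re_ofReal_mul, inner_self_eq_norm_sq (𝕜 := 𝕜)] at hk
  have h1 : RCLike.re ⟪u x₀, f x₀⟫_𝕜 ≤ ‖u x₀‖ * g x₀ :=
    (RCLike.re_le_norm _).trans ((norm_inner_le_norm _ _).trans (mul_le_mul_of_nonneg_left (hfg x₀) (norm_nonneg _)))
  -- hence `Σ_j w (‖u x₀‖ − ‖u nbr‖) ≤ g x₀ − m ‖u x₀‖`
  have h2 : ∑ j, w x₀ j * (‖u x₀‖ - ‖u (nbr x₀ j)‖) ≤ g x₀ - m * ‖u x₀‖ :=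
    le_of_mul_le_mul_left (by nlinarith [hk, h1]) hpos
  -- the difference `ψ = ‖u‖ − φ` is then a strict super-solution at its maximum: contradiction
  have h3 : ∑ j, w x₀ j * ((‖u x₀‖ - φ x₀) - (‖u (nbr x₀ j)‖ - φ (nbr x₀ j))) ≤ -(m * (‖u x₀‖ - φ x₀)) := by
    have he : ∑ j, w x₀ j * ((‖u x₀‖ - φ x₀) - (‖u (nbr x₀ j)‖ - φ (nbr x₀ j))) =
        ∑ j, w x₀ j * (‖u x₀‖ - ‖u (nbr x₀ j)‖) - ∑ j, w x₀ j * (φ x₀ - φ (nbr x₀ j)) := by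
      rw [← Finset.sum_sub_distrib]; exact Finset.sum_congr rfl fun j _ => by ring
    rw [he]; nlinarith [h2, hφ x₀]
  have h4 := sum_nonneg_of_isMax nbr w hw (fun y => ‖u y‖ - φ y) hmax
  nlinarith [h3, h4, hψ, hm]

/-- **SOLVABILITY OF THE COVARIANT RESOLVENT EQUATION** on a finite-dimensional fibre: for every `f` there is `u` with `L u + m u = f` (injective ⟹ surjective);
with `eq_zero_of_resolvent_zero` the solution is unique — the resolvent `(Δ_σ + λI)⁻¹` of [DodziukMathai2006] §1 exists on a finite graph.
[cite: DodziukMathai2006, Lemma 1.1 §1] -/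
theorem exists_resolvent [FiniteDimensional 𝕜 V] (nbr : ι → J → ι) (w : ι → J → ℝ) (hw : ∀ x j, 0 ≤ w x j) (T : ι → J → V →ₗ[𝕜] V)
    (hT : ∀ x j v, ‖T x j v‖ ≤ ‖v‖) {m : ℝ} (hm : 0 < m) (f : ι → V) :
    ∃ u : ι → V, ∀ x, ∑ j, (w x j : 𝕜) • (u x - T x j (u (nbr x j))) + (m : 𝕜) • u x = f x := by
  let A : (ι → V) →ₗ[𝕜] (ι → V) :=
    { toFun := fun u x => ∑ j, (w x j : 𝕜) • (u x - T x j (u (nbr x j))) + (m : 𝕜) • u x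
      map_add' := fun u v => by
        funext x
        simp only [Pi.add_apply, map_add, smul_add, Finset.sum_add_distrib, add_sub_add_comm]
        abel
      map_smul' := fun a u => by
        funext x
        simp only [Pi.smul_apply, map_smul, RingHom.id_apply, smul_add, Finset.smul_sum, ← smul_sub, smul_comm a] }
  have hinj : Function.Injective A := by
    rw [← LinearMap.ker_eq_bot, LinearMap.ker_eq_bot']
    intro u hu
    exact eq_zero_of_resolvent_zero nbr w hw T hT hm fun x => congr_fun hu x
  obtain ⟨u, hu⟩ := (LinearMap.injective_iff_surjective.1 hinj) f
  exact ⟨u, fun x => congr_fun hu x⟩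

/-- **SOLVABILITY OF THE SCALAR RESOLVENT EQUATION**: for every `g` there is `φ` with `L₀φ + mφ = g` — `(Δ + λI)⁻¹` of [DodziukMathai2006] Lemma 1.1 on a finite
weighted graph. [cite: DodziukMathai2006, Lemma 1.1 §1] -/
theorem exists_scalar_resolvent (nbr : ι → J → ι) (w : ι → J → ℝ) (hw : ∀ x j, 0 ≤ w x j) {m : ℝ} (hm : 0 < m) (g : ι → ℝ) :
    ∃ φ : ι → ℝ, ∀ x, ∑ j, w x j * (φ x - φ (nbr x j)) + m * φ x = g x := by
  obtain ⟨φ, hφ⟩ := exists_resolvent (𝕜 := ℝ) (V := ℝ) nbr w hw (fun _ _ => LinearMap.id) (fun _ _ v => le_rfl) hm g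
  refine ⟨φ, fun x => ?_⟩
  have h := hφ x
  simp only [LinearMap.id_apply, smul_eq_mul, RCLike.ofReal_real_eq_id, id_eq] at h
  exact h

end Abstract

/-! ## §3 The chain's covariant Laplace operator (3.23) `Δ^η_U = D*_U D_U` on the `𝔤ᶜ`-valued site functions -/

section Lattice

variable {𝕜 : Type*} [RCLike 𝕜] {d : ℕ} {Pd : Fin d → ℕ} {W : Type*} [NormedAddCommGroup W] [InnerProductSpace 𝕜 W]
  {c₀ : ℝ} [Fact (0 < c₀)]

/-- **(3.23) POINTWISE, IN KATO FORM**: for transporter data with `S(b)R(b) = 1` and a real difference quotient `t`,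
`(Δ^η_U f)(x) = t²·Σ_μ [(f(x) − S(x−e_μ, μ) f(x−e_μ)) + (f(x) − R(x, μ) f(x+e_μ))]`. [cite: Balaban1985BackgroundPropagators, (3.23) p.394, (3.3) p.391, (3.8) p.392] -/
theorem equiv_covLaplaceSiteK_eq_sum (t : ℝ) (R S : Bond d Pd → W →ₗ[𝕜] W) (hSR : ∀ b w, S b (R b w) = w) (f : SiteL2K 𝕜 d Pd c₀ W)
    (x : TSite d Pd) :
    WL2.equiv 𝕜 _ W (covLaplaceSiteK (t : 𝕜) R S f) x =
      ∑ μ, ((t ^ 2 : ℝ) : 𝕜) • ((WL2.equiv 𝕜 _ W f x - S (unshift μ x, μ) (WL2.equiv 𝕜 _ W f (unshift μ x))) +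
        (WL2.equiv 𝕜 _ W f x - R (x, μ) (WL2.equiv 𝕜 _ W f (shift μ x)))) := by
  unfold covLaplaceSiteK
  rw [LinearMap.comp_apply, equiv_covDivL2K, covDiv_apply, equiv_covDerivL2K, Finset.smul_sum]
  refine Finset.sum_congr rfl fun μ _ => ?_
  rw [covDeriv_apply_dir, covDeriv_apply_dir, shift_unshift, map_smul, map_sub, hSR, RCLike.ofReal_pow, sq, ← smul_smul]
  simp only [smul_sub, smul_add]
  abel

/-- **KATO's INEQUALITY FOR (3.23)**: for CONTRACTIVE transporter data (`‖R(b)w‖ ≤ ‖w‖`, `‖S(b)w‖ ≤ ‖w‖`, `S(b)R(b) = 1` — Ad of a unitary background on an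
Ad-invariant fibre norm) and real `t`, at every site `x`:
`‖f(x)‖·t²·Σ_μ[(‖f(x)‖ − ‖f(x−e_μ)‖) + (‖f(x)‖ − ‖f(x+e_μ)‖)] ≤ re⟪f(x), (Δ^η_U f)(x)⟫`. NO small-field hypothesis. [cite: Balaban1985BackgroundPropagators, (3.23) p.394] -/
theorem kato_covLaplaceSiteK (t : ℝ) (R S : Bond d Pd → W →ₗ[𝕜] W) (hSR : ∀ b w, S b (R b w) = w) (hR : ∀ b w, ‖R b w‖ ≤ ‖w‖)
    (hS : ∀ b w, ‖S b w‖ ≤ ‖w‖) (f : SiteL2K 𝕜 d Pd c₀ W) (x : TSite d Pd) :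
    ‖WL2.equiv 𝕜 _ W f x‖ * ∑ μ, t ^ 2 * ((‖WL2.equiv 𝕜 _ W f x‖ - ‖WL2.equiv 𝕜 _ W f (unshift μ x)‖) +
        (‖WL2.equiv 𝕜 _ W f x‖ - ‖WL2.equiv 𝕜 _ W f (shift μ x)‖)) ≤
      RCLike.re ⟪WL2.equiv 𝕜 _ W f x, WL2.equiv 𝕜 _ W (covLaplaceSiteK (t : 𝕜) R S f) x⟫_𝕜 := by
  -- the (3.23) operator in the abstract form of §1 with `J = Fin d ⊕ Fin d`
  set u := WL2.equiv 𝕜 _ W f with hu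
  let nbr : TSite d Pd → Fin d ⊕ Fin d → TSite d Pd := fun y j => Sum.elim (fun μ => unshift μ y) (fun μ => shift μ y) j
  let T : TSite d Pd → Fin d ⊕ Fin d → W →ₗ[𝕜] W := fun y j => Sum.elim (fun μ => S (unshift μ y, μ)) (fun μ => R (y, μ)) j
  have hT : ∀ y j v, ‖T y j v‖ ≤ ‖v‖ := fun y j v => by
    rcases j with μ | μ
    · exact hS _ v
    · exact hR _ v
  have hk := kato_pointwise (𝕜 := 𝕜) nbr (fun _ _ => t ^ 2) (fun _ _ => sq_nonneg t) T hT u x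
  rw [Fintype.sum_sum_type] at hk
  rw [equiv_covLaplaceSiteK_eq_sum t R S hSR f x]
  have hsum : ∑ μ, ((t ^ 2 : ℝ) : 𝕜) • ((u x - S (unshift μ x, μ) (u (unshift μ x))) + (u x - R (x, μ) (u (shift μ x)))) =
      ∑ j, ((t ^ 2 : ℝ) : 𝕜) • (u x - T x j (u (nbr x j))) := by
    rw [Fintype.sum_sum_type, ← Finset.sum_add_distrib]
    refine Finset.sum_congr rfl fun μ _ => ?_
    rw [← smul_add]; rfl
  rw [← hu, hsum]
  refine le_of_eq_of_le ?_ hk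
  congr 1
  rw [← Finset.sum_add_distrib]
  refine Finset.sum_congr rfl fun μ _ => ?_
  simp only [nbr, Sum.elim_inl, Sum.elim_inr]; ring

/-- **`‖(Δ^η_U + m)⁻¹‖_{∞→∞} ≤ m⁻¹` FOR THE CHAIN's (3.23)**: if `Δ^η_U f + m f = g` in `SiteL2K` with contractive transporters, real `t`, `0 < m` and
`‖g(y)‖ ≤ Gs` for all sites `y`, then `‖f(x)‖ ≤ Gs∕m` at every site — level-free, volume-free, every contractive background.
[cite: Balaban1985BackgroundPropagators, (3.23) p.394, (3.39) p.397] -/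
theorem norm_le_of_covLaplaceSiteK_resolvent (t : ℝ) (R S : Bond d Pd → W →ₗ[𝕜] W) (hSR : ∀ b w, S b (R b w) = w)
    (hR : ∀ b w, ‖R b w‖ ≤ ‖w‖) (hS : ∀ b w, ‖S b w‖ ≤ ‖w‖) {m : ℝ} (hm : 0 < m) {f g : SiteL2K 𝕜 d Pd c₀ W}
    (hfg : covLaplaceSiteK (t : 𝕜) R S f + (m : 𝕜) • f = g) {Gs : ℝ} (hGs : ∀ y, ‖WL2.equiv 𝕜 _ W g y‖ ≤ Gs) (x : TSite d Pd) :
    ‖WL2.equiv 𝕜 _ W f x‖ ≤ Gs / m := by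
  let nbr : TSite d Pd → Fin d ⊕ Fin d → TSite d Pd := fun y j => Sum.elim (fun μ => unshift μ y) (fun μ => shift μ y) j
  let T : TSite d Pd → Fin d ⊕ Fin d → W →ₗ[𝕜] W := fun y j => Sum.elim (fun μ => S (unshift μ y, μ)) (fun μ => R (y, μ)) j
  have hT : ∀ y j v, ‖T y j v‖ ≤ ‖v‖ := fun y j v => by
    rcases j with μ | μ
    · exact hS _ v
    · exact hR _ v
  refine norm_le_of_resolvent (𝕜 := 𝕜) nbr (fun _ _ => t ^ 2) (fun _ _ => sq_nonneg t) T hT hm (u := WL2.equiv 𝕜 _ W f)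
    (f := WL2.equiv 𝕜 _ W g) (fun y => ?_) hGs x
  have h := congr_arg (fun h => WL2.equiv 𝕜 _ W h y) hfg
  simp only [WL2.equiv_add, WL2.equiv_smul, Pi.add_apply, Pi.smul_apply] at h
  rw [equiv_covLaplaceSiteK_eq_sum t R S hSR f y] at h
  rw [← h, Fintype.sum_sum_type, ← Finset.sum_add_distrib]
  congr 1
  refine Finset.sum_congr rfl fun μ _ => ?_
  rw [← smul_add]; rfl

/-- **DOMINATION FOR THE CHAIN's (3.23)**: if `Δ^η_U f + m f = g` (contractive transporters, real `t`, `0 < m`) and a real lattice function `φ` solves the FLAT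
scalar equation `t²·Σ_μ[(φ(x) − φ(x−e_μ)) + (φ(x) − φ(x+e_μ))] + m·φ(x) = ψ(x)` with `‖g(x)‖ ≤ ψ(x)` at every site, then `‖f(x)‖ ≤ φ(x)` at every site — the
covariant resolvent is dominated pointwise by the free scalar resolvent. [cite: Balaban1985BackgroundPropagators, (3.23) p.394, (3.39) p.397] -/
theorem norm_le_scalar_of_covLaplaceSiteK_resolvent (t : ℝ) (R S : Bond d Pd → W →ₗ[𝕜] W) (hSR : ∀ b w, S b (R b w) = w)
    (hR : ∀ b w, ‖R b w‖ ≤ ‖w‖) (hS : ∀ b w, ‖S b w‖ ≤ ‖w‖) {m : ℝ} (hm : 0 < m) {f g : SiteL2K 𝕜 d Pd c₀ W}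
    (hfg : covLaplaceSiteK (t : 𝕜) R S f + (m : 𝕜) • f = g) {φ ψ : TSite d Pd → ℝ}
    (hφ : ∀ x, ∑ μ, t ^ 2 * ((φ x - φ (unshift μ x)) + (φ x - φ (shift μ x))) + m * φ x = ψ x)
    (hgψ : ∀ x, ‖WL2.equiv 𝕜 _ W g x‖ ≤ ψ x) (x : TSite d Pd) :
    ‖WL2.equiv 𝕜 _ W f x‖ ≤ φ x := by
  let nbr : TSite d Pd → Fin d ⊕ Fin d → TSite d Pd := fun y j => Sum.elim (fun μ => unshift μ y) (fun μ => shift μ y) j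
  let T : TSite d Pd → Fin d ⊕ Fin d → W →ₗ[𝕜] W := fun y j => Sum.elim (fun μ => S (unshift μ y, μ)) (fun μ => R (y, μ)) j
  have hT : ∀ y j v, ‖T y j v‖ ≤ ‖v‖ := fun y j v => by
    rcases j with μ | μ
    · exact hS _ v
    · exact hR _ v
  refine norm_le_scalar_of_resolvent (𝕜 := 𝕜) nbr (fun _ _ => t ^ 2) (fun _ _ => sq_nonneg t) T hT hm (u := WL2.equiv 𝕜 _ W f)
    (f := WL2.equiv 𝕜 _ W g) (φ := φ) (g := ψ) (fun y => ?_) (fun y => ?_) hgψ x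
  · have h := congr_arg (fun h => WL2.equiv 𝕜 _ W h y) hfg
    simp only [WL2.equiv_add, WL2.equiv_smul, Pi.add_apply, Pi.smul_apply] at h
    rw [equiv_covLaplaceSiteK_eq_sum t R S hSR f y] at h
    rw [← h, Fintype.sum_sum_type, ← Finset.sum_add_distrib]
    congr 1
    refine Finset.sum_congr rfl fun μ _ => ?_
    rw [← smul_add]; rfl
  · rw [← hφ y, Fintype.sum_sum_type, ← Finset.sum_add_distrib]
    congr 1
    refine Finset.sum_congr rfl fun μ _ => ?_
    simp only [nbr, Sum.elim_inl, Sum.elim_inr]; ring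

end Lattice

end Literature.MathematicalPhysics.QuantumFieldTheory.Balaban1983to89.B9Eq323KatoDomination

end
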